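import Summits.ABC.ABC.Theorems.TwistAmplificationSharpModerateLawDefs

/-!
# Crux `TwistAmplification.SharpModerateLaw` (stmt-ABC-1975), line `syzygy-lattice-half-deep-few-primes`:
cone-restricted laws (the honest minimal form of the open core)

The two-parameter laws of `…SharpModerateLawDefs` (`LawWith`, `IndexFormShellLaw`, `SpreadLaw`, `CuspShellLaw`) assert the
dyadic counting law for ALL scales `X, Y ≥ 1`.  The crux only ever consumes them on the CONE of scales that a Szpiro window
`3 < κ ≤ M⁺/N… ≤ σ` can produce: the landed transfer `stub_cuspTransfer` applies the cusp law at `(X_j, 2^j)` with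
`X_j = min(X, 2^{(j+1)/κ})`, where `X_j³ ≤ X_j^κ ≤ 2·2^j` and `2^j ≤ X_j^σ`.  This file types the cone-restricted versions
(constant allowed to depend on `σ`), so that the open core of the line can be promoted in a form that is not stronger than what
the crux needs (lead's analysis, drefute report §6 (i)):

* `LawWithCone P c`, `IndexFormShellLawCone`, `FewDeepLawCone`, `SpreadLawCone` (index-form side; the level of index-form data
  is `186624·`(cusp level), whence the factor in the upper cone condition);
* `CuspShellLawCone`, and the implication names `CuspTransferCone := CuspShellLawCone → SharpModerateLaw`,
  `SyzygyTransferCone := IndexFormShellLawCone → CuspShellLawCone`.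

Each unrestricted law trivially implies its cone version (`lawWithCone_of_lawWith` etc., proved here).
-/

noncomputable section

namespace Summit.ABC.ABC.Theorems.SharpModerateLaw

open Literature.NumberTheory.CubicFields
open scoped BigOperators

/-- Cone-restricted two-parameter dyadic law for the `P`-part with additive constant `c`: only the scales
`X³ ≤ 2Y`, `Y ≤ 186624·X^σ` (every `σ > 6`; constant depending on `σ, ε`). -/
def LawWithCone (P : ℝ → ℝ → BinaryCubic ℤ → ℤ × ℤ → Prop) (c : ℝ) : Prop :=
  ∀ σ : ℝ, 6 < σ → ∀ ε : ℝ, 0 < ε → ∃ C : ℝ, ∀ X Y : ℝ, 1 ≤ X → 1 ≤ Y → X ^ 3 ≤ 2 * Y → Y ≤ 186624 * X ^ σ →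
    (totalCount P X Y : ℝ) ≤ C * (X * Y) ^ ε * (X * Y ^ (-(1 / 6 : ℝ)) + c)

/-- Cone-restricted index-form shell law. -/
def IndexFormShellLawCone : Prop := LawWithCone (fun _ _ _ _ => True) 1

/-- Cone-restricted few-deep law (additive constant `0`). -/
def FewDeepLawCone : Prop := LawWithCone FewDeep 0

/-- Cone-restricted spread law — the honest minimal form of the line's open core. -/
def SpreadLawCone : Prop := LawWithCone (fun X Y F q => ¬ FewDeep X Y F q) 1

/-- Cone-restricted cusp shell law: only the scales `X³ ≤ 2Y`, `Y ≤ X^σ`. -/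
def CuspShellLawCone : Prop :=
  ∀ σ : ℝ, 6 < σ → ∀ ε : ℝ, 0 < ε → ∃ C : ℝ, ∀ X Y : ℝ, 1 ≤ X → 1 ≤ Y → X ^ 3 ≤ 2 * Y → Y ≤ X ^ σ →
    (Set.ncard (cuspShell X Y) : ℝ) ≤ C * (X * Y) ^ ε * (X * Y ^ (-(1 / 6 : ℝ)) + 1)

/-- Statement: the cone-restricted cusp shell law implies the crux. -/
def CuspTransferCone : Prop :=
  CuspShellLawCone → Summit.ABC.ABC.Theses.TwistAmplification.SharpModerateLaw

/-- Statement: the cone-restricted index-form shell law implies the cone-restricted cusp shell law. -/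
def SyzygyTransferCone : Prop :=
  IndexFormShellLawCone → CuspShellLawCone

/-- An unrestricted law implies its cone restriction. -/
theorem lawWithCone_of_lawWith {P : ℝ → ℝ → BinaryCubic ℤ → ℤ × ℤ → Prop} {c : ℝ} (h : LawWith P c) :
    LawWithCone P c := by
  intro σ _ ε hε
  obtain ⟨C, hC⟩ := h ε hε
  exact ⟨C, fun X Y hX hY _ _ => hC X Y hX hY⟩

/-- `SpreadLaw → SpreadLawCone`. -/
theorem spreadLawCone_of_spreadLaw (h : SpreadLaw) : SpreadLawCone := lawWithCone_of_lawWith h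

/-- Registered sub-goal `spreadLaw_implies_cone` of stmt-ABC-1975: the registered open core `SpreadLaw` implies its
cone restriction (so promoting `SpreadLawCone` loses nothing). -/
theorem spreadLaw_implies_cone : SpreadLaw → SpreadLawCone := spreadLawCone_of_spreadLaw

/-- `FewDeepLaw → FewDeepLawCone`. -/
theorem fewDeepLawCone_of_fewDeepLaw (h : FewDeepLaw) : FewDeepLawCone := lawWithCone_of_lawWith h

/-- `IndexFormShellLaw → IndexFormShellLawCone`. -/
theorem indexFormShellLawCone_of_indexFormShellLaw (h : IndexFormShellLaw) : IndexFormShellLawCone :=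
  lawWithCone_of_lawWith h

/-- `CuspShellLaw → CuspShellLawCone`. -/
theorem cuspShellLawCone_of_cuspShellLaw (h : CuspShellLaw) : CuspShellLawCone := by
  intro σ _ ε hε
  obtain ⟨C, hC⟩ := h ε hε
  exact ⟨C, fun X Y hX hY _ _ => hC X Y hX hY⟩

end Summit.ABC.ABC.Theorems.SharpModerateLaw

end
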